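import Mathlib
import Literature.Analysis.FluidPDE.Tao2016AveragedNS.BoundedEternalSolutions
import Summits.NavierStokesRegularity.NavierStokesRegularity.Theorems.TaoLadderRungTwoBreakNoSurvivingEternalViscBddOneWakeDyadicDSSLagDefect

/-!
# Crux `TaoLadderRungTwoBreak.NoSurvivingEternalViscBddOne` (stmt-NavierStokesRegularity-20419) / ⟨20205⟩ `NoSurvivingDSSOne`, DYADIC
# MEMBER, DSS STRATUM: the MASTER IDENTITY — contraction ratio `κ` ⟷ lag defect `D_n` ⟷ lag energy `E_n` — and its consequence:
# BEYOND THE (S₁) THRESHOLD THE OVERSHOOT EXCESS OF EVERY LIT SHELL IS AT LEAST `v_n·D_n/(2(Λ² − κ√κ))`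

MODEL lattice ODEs only (non-negative period-one DSS solutions `V_{k+1}(t) = κV_k(κt)`, `0 < κ < Λ`, of the Katz–Pavlović chain in Tao's
critical variables); nothing in this file is a statement about the Navier–Stokes equations, and no stub, crux, rung or summit is proved by it
(`--supports stmt-NavierStokesRegularity-20419`).  DEF-FREE (both signed quantities enter as explicit integrals):

  lag defect   `D_n := ∫_{(−∞,0)} (√κ·V_n² − 2V_nV_{n+1} + V_{n+1}²/√κ) ≥ 0`        (`…DSSLagDefect`),
  lag energy   `E_n := ∫_{(−∞,0)} V_{n-1}²·(v_n − V_n)`   (positive part: the shell BELOW feeds while shell `n` is still dark — the lag;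
                negative part: it feeds while shell `n` OVERSHOOTS its stranded value).

Eliminating the lifetime feed `∫V_{n-1}²` between the exact (I1) (`…DSSLagDefect.terminal_eq_feed_add_defect`) and the exact (I2)
(`…DSSExactEnergy.lifetimeFlux_eq_dss`, flux `= 2Λ^{1−2n}∫V_{n-1}²V_n`) gives

* **`master_identity`**:   `E_n = Λ·v_n·(v_n − D_n/(2Λ))/(Λ² − κ√κ) − v_n²/(2Λ(1 − κ²/Λ²))`,
  i.e. `1/(1 − κ²/Λ²) = (2Λ²/(Λ² − κ√κ))·(1 − D_n/(2Λv_n)) − 2ΛE_n/v_n²` on a lit shell: the contraction ratio of a DSS front of the dyadic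
  member is an explicit function of its two lag functionals.  READING (`κ = Λ^θ`, `h = log Λ → 0`, `d = D_n/(2Λv_n)`, `E_n ≈ 0`):
  `θ = (2 − 4d)/(5/2 − 4d)` — `d = 0` is the (S₁) threshold `4/5`, `d = 1/4` is Kolmogorov `2/3`: the lag defect IS the selecting quantity.
* **`overshoot_excess_of_threshold`** — if `2κ² − κ√κ ≥ Λ²` (beyond the (S₁) threshold as the base tends to one; the same condition as
  `…DSSOvershootFloor.one_lt_overshootFactor`), then `−E_n ≥ v_n·D_n/(2(Λ² − κ√κ)) ≥ 0`:
  **an (S₁)-surviving DSS front beyond the threshold must, on every shell, overshoot (weighted by the feeding shell's energy) by at least a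
  fixed multiple `≍ 1/log Λ` of its lag defect** — survival forces either a vanishing lag defect (consecutive shells proportional in `L²`: the
  diffuse power-law profile `ψ ∝ u^{-1/2}`, inadmissible in the limit) or an overshoot excess of order `D_n/h`.

HONEST LABEL: elementary consequences of the hand's identity files; W1-dyadic, (ρ0), ⟨20419⟩, ⟨20205⟩ and every NS statement remain OPEN;
rung 0.
-/

-- the summit and its single sub-problem share the name (CONVENTIONS §1)
set_option linter.dupNamespace false

namespace Summit.NavierStokesRegularity.NavierStokesRegularity.Theorems.NoSurvivingEternalViscBddOne.DSSMasterIdentity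

open Filter Topology Set MeasureTheory Finset
open Literature.Analysis.FluidPDE.TaoCascade
open Summit.NavierStokesRegularity.NavierStokesRegularity.Theorems.NoSurvivingEternalViscBddOne

variable {ε₀ κ : ℝ} {V : ℤ → ℝ → ℝ} {v : ℤ → ℝ} {P : ℤ → ℝ → ℝ}

/-- The flux integrand is a constant multiple of `V_{n-1}²V_n`; hence `∫V_{n-1}²V_n = Λ^{2n-1}/2 · ∫Π_{n-1}`-type conversion:
`∫_{(−∞,0)} V_{n-1}²V_n = (2Λ^{-2(n-1)}Λ⁻¹)⁻¹ · ∫_{(−∞,0)} Π_{n-1}`. [elementary] -/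
theorem integral_feedWeighted_eq (hε : 0 < ε₀)
    (hP : ∀ k t, P k t = 2 * (((bigLam ε₀ ^ k)⁻¹) ^ 2 * (bigLam ε₀)⁻¹) * (V k t ^ 2 * V (k + 1) t)) (n : ℤ) :
    ∫ t in Iio 0, V (n - 1) t ^ 2 * V n t
      = (2 * (((bigLam ε₀ ^ (n - 1))⁻¹) ^ 2 * (bigLam ε₀)⁻¹))⁻¹ * ∫ t in Iio 0, P (n - 1) t := by
  have hΛ : 0 < bigLam ε₀ := bigLam_pos (by linarith)
  have hc : 2 * (((bigLam ε₀ ^ (n - 1))⁻¹) ^ 2 * (bigLam ε₀)⁻¹) ≠ 0 := by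
    have : bigLam ε₀ ^ (n - 1) ≠ 0 := zpow_ne_zero _ hΛ.ne'
    positivity
  have h1 : ∫ t in Iio 0, P (n - 1) t
      = ∫ t in Iio 0, 2 * (((bigLam ε₀ ^ (n - 1))⁻¹) ^ 2 * (bigLam ε₀)⁻¹) * (V (n - 1) t ^ 2 * V n t) := by
    refine setIntegral_congr_fun measurableSet_Iio fun t _ => ?_
    rw [hP (n - 1) t, sub_add_cancel]
  rw [h1, integral_const_mul, ← mul_assoc, inv_mul_cancel₀ hc, one_mul]

/-- **THE MASTER IDENTITY.**  On a non-negative period-one DSS front (`0 < κ < Λ`) born at rest with lifetime-integrable feeds, drains and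
fluxes, the lag energy `E_n = ∫V_{n-1}²(v_n − V_n)` of every shell satisfies
`E_n = Λ·v_n·(v_n − D_n/(2Λ))/(Λ² − κ√κ) − v_n²/(2Λ(1 − κ²/Λ²))`, `D_n` the lag defect.
[cite: Tao2016AveragedNS, §1.2, §4 Lemma 4.1 (4.8)–(4.10), §6.4; elementary] -/
theorem master_identity (hε : 0 < ε₀) (hκ : 0 < κ) (hκΛ : κ < bigLam ε₀)
    (hV : ∀ (n : ℤ) (t : ℝ), t < 0 →
      HasDerivAt (V n) (bigLam ε₀ * V (n - 1) t ^ 2 - (bigLam ε₀)⁻¹ * (V n t * V (n + 1) t)) t)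
    (hdss : ∀ (n : ℤ) (t : ℝ), t < 0 → V (n + 1) t = κ * V n (κ * t))
    (hP : ∀ k t, P k t = 2 * (((bigLam ε₀ ^ k)⁻¹) ^ 2 * (bigLam ε₀)⁻¹) * (V k t ^ 2 * V (k + 1) t))
    (hv : ∀ n : ℤ, Tendsto (V n) (𝓝[<] 0) (𝓝 (v n)))
    (hpast : ∀ k : ℤ, Tendsto (V k) atBot (𝓝 0))
    (hsq : ∀ k : ℤ, IntegrableOn (fun t => V k t ^ 2) (Iic 0))
    (hdr : ∀ k : ℤ, IntegrableOn (fun t => V k t * V (k + 1) t) (Iic 0))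
    (hPint : ∀ k : ℤ, IntegrableOn (P k) (Iic 0)) (n : ℤ) :
    ∫ t in Iio 0, V (n - 1) t ^ 2 * (v n - V n t)
      = bigLam ε₀ * v n * (v n - (∫ t in Iio 0, (Real.sqrt κ * V n t ^ 2 - 2 * (V n t * V (n + 1) t)
            + (Real.sqrt κ)⁻¹ * V (n + 1) t ^ 2)) / (2 * bigLam ε₀)) / (bigLam ε₀ ^ 2 - κ * Real.sqrt κ)
        - v n ^ 2 / (2 * bigLam ε₀ * (1 - κ ^ 2 / bigLam ε₀ ^ 2)) := by
  have hΛ : 0 < bigLam ε₀ := bigLam_pos (by linarith)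
  have hΛne : bigLam ε₀ ≠ 0 := hΛ.ne'
  have hκ2 : κ ^ 2 < bigLam ε₀ ^ 2 := pow_lt_pow_left₀ hκΛ hκ.le two_ne_zero
  have hsqrt : Real.sqrt κ < bigLam ε₀ := by
    have hΛ1 : 1 < bigLam ε₀ := Real.one_lt_rpow (by linarith) (by norm_num)
    rw [Real.sqrt_lt' hΛ]; nlinarith
  have hgap : 0 < bigLam ε₀ ^ 2 - κ * Real.sqrt κ := by
    have : κ * Real.sqrt κ < bigLam ε₀ * bigLam ε₀ := mul_lt_mul'' hκΛ hsqrt hκ.le (Real.sqrt_nonneg κ)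
    nlinarith
  have hfac : 0 < bigLam ε₀ - κ * Real.sqrt κ / bigLam ε₀ := by
    rw [sub_pos, div_lt_iff₀ hΛ]; nlinarith
  have hden : 0 < 1 - κ ^ 2 / bigLam ε₀ ^ 2 := by
    rw [sub_pos, div_lt_one (pow_pos hΛ 2)]; exact hκ2
  -- the weighted-feed integrand is integrable (a multiple of the flux)
  have hK : IntegrableOn (fun t => V (n - 1) t ^ 2 * V n t) (Iio 0) := by
    have h := ((hPint (n - 1)).mono_set Iio_subset_Iic_self).const_mul
      (2 * (((bigLam ε₀ ^ (n - 1))⁻¹) ^ 2 * (bigLam ε₀)⁻¹))⁻¹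
    refine IntegrableOn.congr_fun h (fun t _ => ?_) measurableSet_Iio
    have hc : 2 * (((bigLam ε₀ ^ (n - 1))⁻¹) ^ 2 * (bigLam ε₀)⁻¹) ≠ 0 := by
      have : bigLam ε₀ ^ (n - 1) ≠ 0 := zpow_ne_zero _ hΛne
      positivity
    show (2 * ((bigLam ε₀ ^ (n - 1))⁻¹ ^ 2 * (bigLam ε₀)⁻¹))⁻¹ * P (n - 1) t = V (n - 1) t ^ 2 * V n t
    rw [hP (n - 1) t, sub_add_cancel, ← mul_assoc, inv_mul_cancel₀ hc, one_mul]
  have hI : IntegrableOn (fun t => V (n - 1) t ^ 2) (Iio 0) := (hsq (n - 1)).mono_set Iio_subset_Iic_self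
  -- split the lag energy: `∫V²(v − V_n) = v∫V² − ∫V²V_n`
  have hsplit : ∫ t in Iio 0, V (n - 1) t ^ 2 * (v n - V n t)
      = v n * (∫ t in Iio 0, V (n - 1) t ^ 2) - ∫ t in Iio 0, V (n - 1) t ^ 2 * V n t := by
    have e : (fun t => V (n - 1) t ^ 2 * (v n - V n t)) = fun t => v n * V (n - 1) t ^ 2 - V (n - 1) t ^ 2 * V n t := by
      funext t; ring
    rw [e, integral_sub (hI.const_mul _) hK, integral_const_mul]
  -- the weighted feed from the exact flux
  have hflux := DSSExactEnergy.lifetimeFlux_eq_dss hε hκ hκΛ hV hdss hP hv hpast hPint (n - 1)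
  rw [sub_add_cancel] at hflux
  have hKval : ∫ t in Iio 0, V (n - 1) t ^ 2 * V n t = v n ^ 2 / (2 * bigLam ε₀ * (1 - κ ^ 2 / bigLam ε₀ ^ 2)) := by
    rw [integral_feedWeighted_eq hε hP n, hflux, zpow_sub_one₀ hΛne n]
    have : bigLam ε₀ ^ n ≠ 0 := zpow_ne_zero n hΛne
    field_simp
  -- the feed from the exact (I1)
  have hfeed := DSSLagDefect.terminal_eq_feed_add_defect hε hκ hV hdss hv hpast hsq hdr n
  set D := ∫ t in Iio 0, (Real.sqrt κ * V n t ^ 2 - 2 * (V n t * V (n + 1) t) + (Real.sqrt κ)⁻¹ * V (n + 1) t ^ 2) with hD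
  have hIval : ∫ t in Iio 0, V (n - 1) t ^ 2 = (v n - D / (2 * bigLam ε₀)) / (bigLam ε₀ - κ * Real.sqrt κ / bigLam ε₀) := by
    rw [eq_div_iff hfac.ne']
    have : v n - D / (2 * bigLam ε₀) = (bigLam ε₀ - κ * Real.sqrt κ / bigLam ε₀) * ∫ t in Iio 0, V (n - 1) t ^ 2 := by
      rw [hfeed]; ring
    rw [this]; ring
  rw [hsplit, hKval, hIval]
  have e2 : v n * ((v n - D / (2 * bigLam ε₀)) / (bigLam ε₀ - κ * Real.sqrt κ / bigLam ε₀))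
      = bigLam ε₀ * v n * (v n - D / (2 * bigLam ε₀)) / (bigLam ε₀ ^ 2 - κ * Real.sqrt κ) := by
    field_simp
  rw [e2]

/-- **OVERSHOOT EXCESS BEYOND THE THRESHOLD.**  Under the hypotheses of `master_identity`, if `2κ² − κ√κ ≥ Λ²` (beyond the (S₁) threshold as
the base tends to one) and the shell is lit (`v_n ≥ 0` suffices), then the lag energy is NEGATIVE by at least a multiple of the lag defect:
`v_n·D_n/(2(Λ² − κ√κ)) ≤ −E_n = ∫V_{n-1}²(V_n − v_n)`.
[cite: Tao2016AveragedNS, §1.2, §4 Lemma 4.1 (4.8)–(4.10), §6.4; elementary] -/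
theorem overshoot_excess_of_threshold (hε : 0 < ε₀) (hκ : 0 < κ) (hκΛ : κ < bigLam ε₀)
    (hV : ∀ (n : ℤ) (t : ℝ), t < 0 →
      HasDerivAt (V n) (bigLam ε₀ * V (n - 1) t ^ 2 - (bigLam ε₀)⁻¹ * (V n t * V (n + 1) t)) t)
    (hpos : ∀ (n : ℤ) (t : ℝ), t < 0 → 0 ≤ V n t)
    (hdss : ∀ (n : ℤ) (t : ℝ), t < 0 → V (n + 1) t = κ * V n (κ * t))
    (hP : ∀ k t, P k t = 2 * (((bigLam ε₀ ^ k)⁻¹) ^ 2 * (bigLam ε₀)⁻¹) * (V k t ^ 2 * V (k + 1) t))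
    (hv : ∀ n : ℤ, Tendsto (V n) (𝓝[<] 0) (𝓝 (v n)))
    (hpast : ∀ k : ℤ, Tendsto (V k) atBot (𝓝 0))
    (hsq : ∀ k : ℤ, IntegrableOn (fun t => V k t ^ 2) (Iic 0))
    (hdr : ∀ k : ℤ, IntegrableOn (fun t => V k t * V (k + 1) t) (Iic 0))
    (hPint : ∀ k : ℤ, IntegrableOn (P k) (Iic 0))
    (hthr : bigLam ε₀ ^ 2 ≤ 2 * κ ^ 2 - κ * Real.sqrt κ) (n : ℤ) :
    v n * (∫ t in Iio 0, (Real.sqrt κ * V n t ^ 2 - 2 * (V n t * V (n + 1) t)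
          + (Real.sqrt κ)⁻¹ * V (n + 1) t ^ 2)) / (2 * (bigLam ε₀ ^ 2 - κ * Real.sqrt κ))
      ≤ -(∫ t in Iio 0, V (n - 1) t ^ 2 * (v n - V n t)) := by
  have hΛ : 0 < bigLam ε₀ := bigLam_pos (by linarith)
  have hκ2 : κ ^ 2 < bigLam ε₀ ^ 2 := pow_lt_pow_left₀ hκΛ hκ.le two_ne_zero
  have hsqrt : Real.sqrt κ < bigLam ε₀ := by
    have hΛ1 : 1 < bigLam ε₀ := Real.one_lt_rpow (by linarith) (by norm_num)
    rw [Real.sqrt_lt' hΛ]; nlinarith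
  have hgap : 0 < bigLam ε₀ ^ 2 - κ * Real.sqrt κ := by
    have : κ * Real.sqrt κ < bigLam ε₀ * bigLam ε₀ := mul_lt_mul'' hκΛ hsqrt hκ.le (Real.sqrt_nonneg κ)
    nlinarith
  have hden : 0 < 1 - κ ^ 2 / bigLam ε₀ ^ 2 := by
    rw [sub_pos, div_lt_one (pow_pos hΛ 2)]; exact hκ2
  have hvn : 0 ≤ v n := ge_of_tendsto (hv n) (eventually_nhdsWithin_of_forall fun t ht => hpos n t ht)
  rw [master_identity hε hκ hκΛ hV hdss hP hv hpast hsq hdr hPint n]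
  set D := ∫ t in Iio 0, (Real.sqrt κ * V n t ^ 2 - 2 * (V n t * V (n + 1) t) + (Real.sqrt κ)⁻¹ * V (n + 1) t ^ 2) with hD
  -- `−E = v²/(2Λ(1−r)) − Λv(v − D/(2Λ))/(Λ²−κ√κ) = v²[1/(2Λ(1−r)) − Λ/(Λ²−κ√κ)] + v D/(2(Λ²−κ√κ))`
  -- and the bracket is `≥ 0` iff `Λ² − κ√κ ≥ 2Λ²(1−r) = 2(Λ² − κ²)` iff `2κ² − κ√κ ≥ Λ²`.
  have hbr : 0 ≤ 1 / (2 * bigLam ε₀ * (1 - κ ^ 2 / bigLam ε₀ ^ 2)) - bigLam ε₀ / (bigLam ε₀ ^ 2 - κ * Real.sqrt κ) := by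
    rw [sub_nonneg, div_le_div_iff₀ hgap (by positivity)]
    have e : 2 * bigLam ε₀ * (1 - κ ^ 2 / bigLam ε₀ ^ 2) = 2 * (bigLam ε₀ ^ 2 - κ ^ 2) / bigLam ε₀ := by
      field_simp
    rw [e]
    rw [show bigLam ε₀ * (2 * (bigLam ε₀ ^ 2 - κ ^ 2) / bigLam ε₀) = 2 * (bigLam ε₀ ^ 2 - κ ^ 2) by field_simp]
    linarith
  have hv2 : 0 ≤ v n ^ 2 * (1 / (2 * bigLam ε₀ * (1 - κ ^ 2 / bigLam ε₀ ^ 2)) - bigLam ε₀ / (bigLam ε₀ ^ 2 - κ * Real.sqrt κ)) :=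
    mul_nonneg (sq_nonneg _) hbr
  have e : -(bigLam ε₀ * v n * (v n - D / (2 * bigLam ε₀)) / (bigLam ε₀ ^ 2 - κ * Real.sqrt κ)
        - v n ^ 2 / (2 * bigLam ε₀ * (1 - κ ^ 2 / bigLam ε₀ ^ 2)))
      = v n ^ 2 * (1 / (2 * bigLam ε₀ * (1 - κ ^ 2 / bigLam ε₀ ^ 2)) - bigLam ε₀ / (bigLam ε₀ ^ 2 - κ * Real.sqrt κ))
        + v n * D / (2 * (bigLam ε₀ ^ 2 - κ * Real.sqrt κ)) := by
    field_simp
    ring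
  rw [e]
  linarith

end Summit.NavierStokesRegularity.NavierStokesRegularity.Theorems.NoSurvivingEternalViscBddOne.DSSMasterIdentity
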